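import Summits.CriticalPhenomena.PercolationContinuityZ3.Theorems.PercNonProliferationSubpolynomialBlockingStubCruxIffSeedSubpoly
import Summits.CriticalPhenomena.PercolationContinuityZ3.Theorems.PercNonProliferationSubpolynomialBlockingStubShieldCover
import Summits.CriticalPhenomena.PercolationContinuityZ3.Theorems.PercNonProliferationSubpolynomialBlockingStubHarrisShields
import Summits.CriticalPhenomena.PercolationContinuityZ3.Theorems.PercNonProliferationSubpolynomialBlockingStubEnclosureOfBlocking
import Summits.CriticalPhenomena.PercolationContinuityZ3.Theorems.PercNonProliferationSubpolynomialBlockingSubsurface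
import HarnessLib

/-!
# Crux `PercNonProliferation.SubpolynomialBlocking` (stmt-CriticalPhenomena-4446), line `root-trick-wall-patch` —
# the line's certificate: crux ⟺ `WallPatchEnclosureSubpoly`, and the wall-patch floor

Helper file for the crux skeleton `Cruxes/SubpolynomialBlocking/Lines/root_trick_wall_patch.lean`
(lead prover-line-stmt-CriticalPhenomena-4446-c3-0). It discharges the skeleton's composition
`crux_iff_wallPatch` / `SubpolynomialBlocking_of` UNCONDITIONALLY in its three provable stubs, which are
landed (`stub_shieldCover` p97113, `stub_harrisShields` p96555, `stub_enclosureOfBlocking` p98377), through the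
landed reduction of the crux to one flat box (`stub_cruxIffSeedSubpoly` p86229). Lands `--supports 4446`;
the registered signature proved verbatim is `stub_cruxIffWallPatch`.

## Objects (tree vocabulary, written out in every statement; all probabilities at `p_c(ℤ³)`)

* wall patch `P_r = {x | x₀ = 0, 0 ≤ x₁ < r, 0 ≤ x₂ < r}`; half-space ball
  `B_r = Set.Icc ![0,-4r,-4r] ![4r, 5r-1, 5r-1]` (= `ℍ ∩ B⁺(P_r, 4r)`); far face `F_r` = points of `B_r` with
  `x₀ = 4r ∨ x₁ ∈ {-4r, 5r-1} ∨ x₂ ∈ {-4r, 5r-1}`;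
* `h(r) := P((openCrossing B_r P_r F_r)ᶜ)` — the critical WALL-PATCH ENCLOSURE probability;
* `C⁺ = WallPatchEnclosureSubpoly := ∀ s > 0, ∀ᶠ r, r^{-s} ≤ h(r)` (the line's one open stub, `stub_wallPatchEnclosure`);
* `seed₂(n) := P(no open path inside Set.Icc 0 ![n, n+⌊n/2⌋, n+⌊n/2⌋] from {x₀ = 0} to {x₀ = n})`;
* `u_m = Negative.blockProb 3 p_c m` — the crux's annulus-blocking probability.

## Results

* `StubCruxIffWallPatch.pow_h_le_seed` : `h(⌊n/5⌋)^100 ≤ seed₂(n)` for `n ≥ 20` (root trick + Harris: stubs 1 + 2);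
* `StubCruxIffWallPatch.seedSubpoly_of_wallPatch` : `C⁺ ⇒ (∀ s>0, ∀ᶠ n, n^{-s} ≤ seed₂(n))`;
* `StubCruxIffWallPatch.wallPatch_of_crux` : crux ⇒ `C⁺` (stub 4: `u_{⌈r/2⌉} ≤ h(r)`);
* `stub_cruxIffWallPatch` : **crux ⟺ `C⁺`** (registered signature) — the transfer target of the line is an
  exact relocation of the crux to the wall, so every kill / proof of `C⁺` is one of the crux;
* `subpolynomialBlocking_of_wallPatchEnclosure` : `C⁺ ⇒` the crux decl by name (the skeleton's
  `SubpolynomialBlocking_of` with its front end discharged);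
* `wallPatchEnclosure_floor` : `∀ ε > 0, ∀ᶠ r, exp(-ε r²) ≤ h(r)` — the line's open stub inherits the
  sub-surface-order floor of the crux (`subsurfaceBlocking` p111169 through stub 4); against the claimed `r^{-s}`.
-/

noncomputable section

namespace Summit.CriticalPhenomena.PercolationContinuityZ3.Theorems.SubpolynomialBlocking

open MeasureTheory Filter Topology
open Literature.Probability.Percolation Literature.Probability.LatticeModels
open Summit.CriticalPhenomena.PercolationContinuityZ3.Theorems.SubpolynomialBlocking.Negative

namespace StubCruxIffWallPatch

/-! ## Arithmetic of the patch scale `r(n) = ⌊n/5⌋` -/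

/-- `4 ≤ ⌊n/5⌋`, `4⌊n/5⌋ < n`, `⌊n/5⌋ ≤ n` and the covering inequality `n + ⌊n/2⌋ < 10 ⌊n/5⌋` for `n ≥ 20`. -/
theorem div_five_bounds {n : ℕ} (hn : 20 ≤ n) :
    4 ≤ n / 5 ∧ 4 * (n / 5) < n ∧ n / 5 ≤ n ∧ n + n / 2 < 10 * (n / 5) := by
  omega

/-- `⌊n/5⌋ → ∞`. -/
theorem tendsto_div_five : Tendsto (fun n : ℕ => n / 5) atTop atTop := by
  refine tendsto_atTop_atTop.2 fun b => ⟨5 * b, fun n hn => ?_⟩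
  omega

/-- Real-analysis glue: `r^{-s} = (r^{-s/100})^{100}` for `r > 0`. -/
theorem rpow_neg_eq_pow_hundred {r : ℝ} (hr : 0 < r) (s : ℝ) :
    r ^ (-s) = (r ^ (-(s / 100))) ^ (100 : ℕ) := by
  rw [← Real.rpow_natCast, ← Real.rpow_mul hr.le]
  congr 1
  push_cast
  ring

/-! ## Stubs 1 + 2: `h(⌊n/5⌋)^100 ≤ seed₂(n)` -/

/-- **Root trick + Harris**: for `n ≥ 20`, with `r = ⌊n/5⌋`,
`h(r)^100 ≤ P(⋂_{100 cells} shield) ≤ seed₂(n)`: the second inequality is the deterministic covering /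
first-exit statement `stub_shieldCover` transported to the measure (supported on lattice configurations,
`DCT16.real_mono_of_forall_subset_edgeSet`), the first is `stub_harrisShields`. -/
theorem pow_h_le_seed {n : ℕ} (hn : 20 ≤ n) :
    (bondPercolation (zdGraph 3) (criticalProbI 3)).real
        (openCrossing
          (Set.Icc (![0, -(4 * ((n / 5 : ℕ) : ℤ)), -(4 * ((n / 5 : ℕ) : ℤ))] : Site 3)
            ![4 * ((n / 5 : ℕ) : ℤ), 5 * ((n / 5 : ℕ) : ℤ) - 1, 5 * ((n / 5 : ℕ) : ℤ) - 1])
          {x : Site 3 | x 0 = 0 ∧ 0 ≤ x 1 ∧ x 1 < ((n / 5 : ℕ) : ℤ) ∧ 0 ≤ x 2 ∧ x 2 < ((n / 5 : ℕ) : ℤ)}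
          {y : Site 3 | y ∈ Set.Icc (![0, -(4 * ((n / 5 : ℕ) : ℤ)), -(4 * ((n / 5 : ℕ) : ℤ))] : Site 3)
              ![4 * ((n / 5 : ℕ) : ℤ), 5 * ((n / 5 : ℕ) : ℤ) - 1, 5 * ((n / 5 : ℕ) : ℤ) - 1] ∧
            (y 0 = 4 * ((n / 5 : ℕ) : ℤ) ∨ y 1 = -(4 * ((n / 5 : ℕ) : ℤ)) ∨ y 1 = 5 * ((n / 5 : ℕ) : ℤ) - 1 ∨
              y 2 = -(4 * ((n / 5 : ℕ) : ℤ)) ∨ y 2 = 5 * ((n / 5 : ℕ) : ℤ) - 1)})ᶜ ^ 100 ≤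
      (bondPercolation (zdGraph 3) (criticalProbI 3)).real
        (openCrossing (Set.Icc (0 : Site 3) ![(n : ℤ), (n : ℤ) + (n / 2 : ℕ), (n : ℤ) + (n / 2 : ℕ)])
          {x | x ∈ Set.Icc (0 : Site 3) ![(n : ℤ), (n : ℤ) + (n / 2 : ℕ), (n : ℤ) + (n / 2 : ℕ)] ∧ x 0 = 0}
          {y | y ∈ Set.Icc (0 : Site 3) ![(n : ℤ), (n : ℤ) + (n / 2 : ℕ), (n : ℤ) + (n / 2 : ℕ)] ∧
            y 0 = (n : ℤ)})ᶜ := by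
  obtain ⟨hr4, hr, -, hcover⟩ := div_five_bounds hn
  refine (stub_harrisShields (n / 5)).trans ?_
  exact DCT16.real_mono_of_forall_subset_edgeSet (zdGraph 3) (criticalProbI 3)
    fun ω hω hmem => stub_shieldCover n (n / 5) (by omega) hr hcover ω hω fun c => Set.mem_iInter.1 hmem c

/-! ## + Stub 3 (`C⁺`, as a hypothesis): the seed is sub-polynomial, hence the crux -/

/-- **`C⁺ ⇒ SeedSubpoly 2`**: with `r = ⌊n/5⌋ → ∞`, `n^{-s} ≤ r^{-s} = (r^{-s/100})^{100} ≤ h(r)^{100} ≤ seed₂(n)`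
eventually. -/
theorem seedSubpoly_of_wallPatch
    (hwall : ∀ s : ℝ, 0 < s → ∀ᶠ r : ℕ in atTop, (r : ℝ) ^ (-s) ≤
      (bondPercolation (zdGraph 3) (criticalProbI 3)).real
          (openCrossing
            (Set.Icc (![0, -(4 * (r : ℤ)), -(4 * (r : ℤ))] : Site 3) ![4 * (r : ℤ), 5 * (r : ℤ) - 1, 5 * (r : ℤ) - 1])
            {x : Site 3 | x 0 = 0 ∧ 0 ≤ x 1 ∧ x 1 < (r : ℤ) ∧ 0 ≤ x 2 ∧ x 2 < (r : ℤ)}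
            {y : Site 3 | y ∈ Set.Icc (![0, -(4 * (r : ℤ)), -(4 * (r : ℤ))] : Site 3)
                ![4 * (r : ℤ), 5 * (r : ℤ) - 1, 5 * (r : ℤ) - 1] ∧
              (y 0 = 4 * (r : ℤ) ∨ y 1 = -(4 * (r : ℤ)) ∨ y 1 = 5 * (r : ℤ) - 1 ∨
                y 2 = -(4 * (r : ℤ)) ∨ y 2 = 5 * (r : ℤ) - 1)})ᶜ) :
    ∀ s : ℝ, 0 < s → ∀ᶠ n : ℕ in atTop, (n : ℝ) ^ (-s) ≤
      (bondPercolation (zdGraph 3) (criticalProbI 3)).real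
        (openCrossing (Set.Icc (0 : Site 3) ![(n : ℤ), (n : ℤ) + (n / 2 : ℕ), (n : ℤ) + (n / 2 : ℕ)])
          {x | x ∈ Set.Icc (0 : Site 3) ![(n : ℤ), (n : ℤ) + (n / 2 : ℕ), (n : ℤ) + (n / 2 : ℕ)] ∧ x 0 = 0}
          {y | y ∈ Set.Icc (0 : Site 3) ![(n : ℤ), (n : ℤ) + (n / 2 : ℕ), (n : ℤ) + (n / 2 : ℕ)] ∧
            y 0 = (n : ℤ)})ᶜ := by
  intro s hs
  have hev := tendsto_div_five.eventually (hwall (s / 100) (by positivity))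
  filter_upwards [hev, eventually_ge_atTop 20] with n hn h20
  obtain ⟨hr4, -, hrn, -⟩ := div_five_bounds h20
  have hr0 : (0 : ℝ) < ((n / 5 : ℕ) : ℝ) := by exact_mod_cast (lt_of_lt_of_le (by norm_num) hr4)
  have hrn' : ((n / 5 : ℕ) : ℝ) ≤ (n : ℝ) := by exact_mod_cast hrn
  have hpow_nonneg : 0 ≤ ((n / 5 : ℕ) : ℝ) ^ (-(s / 100)) := Real.rpow_nonneg hr0.le _
  calc (n : ℝ) ^ (-s)
      ≤ ((n / 5 : ℕ) : ℝ) ^ (-s) := Real.rpow_le_rpow_of_nonpos hr0 hrn' (by linarith)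
    _ = (((n / 5 : ℕ) : ℝ) ^ (-(s / 100))) ^ (100 : ℕ) := rpow_neg_eq_pow_hundred hr0 s
    _ ≤ _ := pow_le_pow_left₀ hpow_nonneg hn 100
    _ ≤ _ := pow_h_le_seed h20

/-! ## Stub 4: crux ⇒ `C⁺` -/

/-- **crux ⇒ `C⁺`**: `h(r) ≥ u_{⌈r/2⌉} ≥ ⌈r/2⌉^{-s} ≥ r^{-s}` eventually (`stub_enclosureOfBlocking`). -/
theorem wallPatch_of_crux
    (hcrux : Summit.CriticalPhenomena.PercolationContinuityZ3.Theses.PercNonProliferation.SubpolynomialBlocking) :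
    ∀ s : ℝ, 0 < s → ∀ᶠ r : ℕ in atTop, (r : ℝ) ^ (-s) ≤
      (bondPercolation (zdGraph 3) (criticalProbI 3)).real
          (openCrossing
            (Set.Icc (![0, -(4 * (r : ℤ)), -(4 * (r : ℤ))] : Site 3) ![4 * (r : ℤ), 5 * (r : ℤ) - 1, 5 * (r : ℤ) - 1])
            {x : Site 3 | x 0 = 0 ∧ 0 ≤ x 1 ∧ x 1 < (r : ℤ) ∧ 0 ≤ x 2 ∧ x 2 < (r : ℤ)}
            {y : Site 3 | y ∈ Set.Icc (![0, -(4 * (r : ℤ)), -(4 * (r : ℤ))] : Site 3)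
                ![4 * (r : ℤ), 5 * (r : ℤ) - 1, 5 * (r : ℤ) - 1] ∧
              (y 0 = 4 * (r : ℤ) ∨ y 1 = -(4 * (r : ℤ)) ∨ y 1 = 5 * (r : ℤ) - 1 ∨
                y 2 = -(4 * (r : ℤ)) ∨ y 2 = 5 * (r : ℤ) - 1)})ᶜ := by
  intro s hs
  have hu : ∀ᶠ m : ℕ in atTop, (m : ℝ) ^ (-s) ≤ blockProb 3 (criticalProbI 3) m :=
    (subpolynomialBlockingAt_iff 3 (criticalProbI 3)).1 (crux_iff.1 hcrux) s hs
  have htend : Tendsto (fun r : ℕ => (r + 1) / 2) atTop atTop :=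
    tendsto_atTop_atTop.2 fun b => ⟨2 * b, fun n hn => by omega⟩
  have hev : ∀ᶠ r : ℕ in atTop,
      (((r + 1) / 2 : ℕ) : ℝ) ^ (-s) ≤ blockProb 3 (criticalProbI 3) ((r + 1) / 2) :=
    htend.eventually hu
  filter_upwards [hev, eventually_ge_atTop 1] with r hr h1
  have hm1 : 1 ≤ (r + 1) / 2 := by omega
  have hm0 : (0 : ℝ) < (((r + 1) / 2 : ℕ) : ℝ) := by exact_mod_cast hm1
  have hmr : (((r + 1) / 2 : ℕ) : ℝ) ≤ (r : ℝ) := by exact_mod_cast (show (r + 1) / 2 ≤ r by omega)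
  calc (r : ℝ) ^ (-s) ≤ (((r + 1) / 2 : ℕ) : ℝ) ^ (-s) := Real.rpow_le_rpow_of_nonpos hm0 hmr (by linarith)
    _ ≤ blockProb 3 (criticalProbI 3) ((r + 1) / 2) := hr
    _ ≤ _ := stub_enclosureOfBlocking r h1

end StubCruxIffWallPatch

/-- **`C⁺` ⇒ the crux, by name** (the skeleton's `SubpolynomialBlocking_of` with its front end — stubs 1, 2 —
discharged by the landed `stub_shieldCover` / `stub_harrisShields`): if the critical wall-patch enclosure
probability `h(r)` is `≥ r^{-s}` eventually for every `s > 0`, then the flat seed `seed₂(n)` is sub-polynomial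
(`StubCruxIffWallPatch.seedSubpoly_of_wallPatch`), hence the crux by the landed `stub_cruxIffSeedSubpoly 2`. -/
theorem subpolynomialBlocking_of_wallPatchEnclosure
    (hwall : ∀ s : ℝ, 0 < s → ∀ᶠ r : ℕ in atTop, (r : ℝ) ^ (-s) ≤
      (bondPercolation (zdGraph 3) (criticalProbI 3)).real
          (openCrossing
            (Set.Icc (![0, -(4 * (r : ℤ)), -(4 * (r : ℤ))] : Site 3) ![4 * (r : ℤ), 5 * (r : ℤ) - 1, 5 * (r : ℤ) - 1])
            {x : Site 3 | x 0 = 0 ∧ 0 ≤ x 1 ∧ x 1 < (r : ℤ) ∧ 0 ≤ x 2 ∧ x 2 < (r : ℤ)}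
            {y : Site 3 | y ∈ Set.Icc (![0, -(4 * (r : ℤ)), -(4 * (r : ℤ))] : Site 3)
                ![4 * (r : ℤ), 5 * (r : ℤ) - 1, 5 * (r : ℤ) - 1] ∧
              (y 0 = 4 * (r : ℤ) ∨ y 1 = -(4 * (r : ℤ)) ∨ y 1 = 5 * (r : ℤ) - 1 ∨
                y 2 = -(4 * (r : ℤ)) ∨ y 2 = 5 * (r : ℤ) - 1)})ᶜ) :
    Summit.CriticalPhenomena.PercolationContinuityZ3.Theses.PercNonProliferation.SubpolynomialBlocking :=
  (stub_cruxIffSeedSubpoly 2 le_rfl).2 (StubCruxIffWallPatch.seedSubpoly_of_wallPatch hwall)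

/-- **The line's certificate: crux ⟺ `WallPatchEnclosureSubpoly`** (registered on crux stmt-CriticalPhenomena-4446,
line `root-trick-wall-patch`, as `stub_cruxIffWallPatch`). The critical annulus-blocking probability of `ℤ³` decays
slower than any power iff the critical WALL-PATCH ENCLOSURE probability does:
`(∀ s>0, ∀ᶠ n, n^{-s} ≤ u_n) ↔ (∀ s>0, ∀ᶠ r, r^{-s} ≤ h(r))`, `h(r) = P_{p_c}`(no open path inside
`ℍ ∩ B⁺(P_r,4r) = [0,4r]×[-4r,5r-1]²` from the wall patch `P_r = {0}×[0,r)²` to sup-distance `4r`).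
`⇒` is `stub_enclosureOfBlocking` (`u_{⌈r/2⌉} ≤ h(r)`: a translate of the crux's annulus sits in the half-space
ball around the patch); `⇐` is the root trick (`stub_shieldCover`: 100 shielded wall cells seal the flat box
`[0,n]×[0,n+⌊n/2⌋]²`, `stub_harrisShields`: Harris–FKG, `h^{100} ≤ P(all shielded)`) followed by the certified
reduction of the crux to that flat box (`stub_cruxIffSeedSubpoly 2`). So `C⁺` is an exact relocation of the crux to
the wall, neither weaker nor stronger; in particular it is false for every `p > p_c` and in `d ≥ 7` under `η = 0`
exactly like the crux (Negative/OffCritical, Negative/AboveSix). -/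
theorem stub_cruxIffWallPatch :
    Summit.CriticalPhenomena.PercolationContinuityZ3.Theses.PercNonProliferation.SubpolynomialBlocking ↔
      ∀ s : ℝ, 0 < s → ∀ᶠ r : ℕ in atTop, (r : ℝ) ^ (-s) ≤
        (bondPercolation (zdGraph 3) (criticalProbI 3)).real
          (openCrossing
            (Set.Icc (![0, -(4 * (r : ℤ)), -(4 * (r : ℤ))] : Site 3) ![4 * (r : ℤ), 5 * (r : ℤ) - 1, 5 * (r : ℤ) - 1])
            {x : Site 3 | x 0 = 0 ∧ 0 ≤ x 1 ∧ x 1 < (r : ℤ) ∧ 0 ≤ x 2 ∧ x 2 < (r : ℤ)}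
            {y : Site 3 | y ∈ Set.Icc (![0, -(4 * (r : ℤ)), -(4 * (r : ℤ))] : Site 3)
                ![4 * (r : ℤ), 5 * (r : ℤ) - 1, 5 * (r : ℤ) - 1] ∧
              (y 0 = 4 * (r : ℤ) ∨ y 1 = -(4 * (r : ℤ)) ∨ y 1 = 5 * (r : ℤ) - 1 ∨
                y 2 = -(4 * (r : ℤ)) ∨ y 2 = 5 * (r : ℤ) - 1)})ᶜ :=
  ⟨StubCruxIffWallPatch.wallPatch_of_crux, subpolynomialBlocking_of_wallPatchEnclosure⟩

/-- **The wall-patch floor**: for every `ε > 0`, eventually in `r`, `exp(-ε r²) ≤ h(r)` — the line's open stub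
`C⁺` (which claims `r^{-s}`) holds at least at sub-surface order, because `h(r) ≥ u_{⌈r/2⌉}` (`stub_enclosureOfBlocking`)
and `u_m ≥ exp(-ε m²)` eventually (`subsurfaceBlocking`, lead c2: exploration + Harris + Cerf–Dembin symmetry +
BGN `θ_ℍ(p_c) = 0`), with `⌈r/2⌉² ≤ r²`. Nothing between this and `r^{-s}` is known; a half-space one-arm RATE
`P_{p_c}(0 ↔ height t in ℍ) ≤ t^{-a}` would lift the exponent `2` to `2 - a` (`Subsurface.blockProb_ge_rpow`). -/
theorem wallPatchEnclosure_floor :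
    ∀ ε : ℝ, 0 < ε → ∀ᶠ r : ℕ in atTop, Real.exp (-(ε * (r : ℝ) ^ 2)) ≤
      (bondPercolation (zdGraph 3) (criticalProbI 3)).real
          (openCrossing
            (Set.Icc (![0, -(4 * (r : ℤ)), -(4 * (r : ℤ))] : Site 3) ![4 * (r : ℤ), 5 * (r : ℤ) - 1, 5 * (r : ℤ) - 1])
            {x : Site 3 | x 0 = 0 ∧ 0 ≤ x 1 ∧ x 1 < (r : ℤ) ∧ 0 ≤ x 2 ∧ x 2 < (r : ℤ)}
            {y : Site 3 | y ∈ Set.Icc (![0, -(4 * (r : ℤ)), -(4 * (r : ℤ))] : Site 3)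
                ![4 * (r : ℤ), 5 * (r : ℤ) - 1, 5 * (r : ℤ) - 1] ∧
              (y 0 = 4 * (r : ℤ) ∨ y 1 = -(4 * (r : ℤ)) ∨ y 1 = 5 * (r : ℤ) - 1 ∨
                y 2 = -(4 * (r : ℤ)) ∨ y 2 = 5 * (r : ℤ) - 1)})ᶜ := by
  intro ε hε
  have hu : ∀ᶠ m : ℕ in atTop, Real.exp (-(ε * (m : ℝ) ^ 2)) ≤ blockProb 3 (criticalProbI 3) m :=
    subsurfaceBlocking ε hε
  have htend : Tendsto (fun r : ℕ => (r + 1) / 2) atTop atTop :=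
    tendsto_atTop_atTop.2 fun b => ⟨2 * b, fun n hn => by omega⟩
  have hev : ∀ᶠ r : ℕ in atTop,
      Real.exp (-(ε * ((((r + 1) / 2 : ℕ) : ℝ)) ^ 2)) ≤ blockProb 3 (criticalProbI 3) ((r + 1) / 2) :=
    htend.eventually hu
  filter_upwards [hev, eventually_ge_atTop 1] with r hr h1
  have hmr : (((r + 1) / 2 : ℕ) : ℝ) ≤ (r : ℝ) := by exact_mod_cast (show (r + 1) / 2 ≤ r by omega)
  have hm0 : (0 : ℝ) ≤ (((r + 1) / 2 : ℕ) : ℝ) := Nat.cast_nonneg _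
  have hsq : (((r + 1) / 2 : ℕ) : ℝ) ^ 2 ≤ (r : ℝ) ^ 2 := pow_le_pow_left₀ hm0 hmr 2
  calc Real.exp (-(ε * (r : ℝ) ^ 2))
      ≤ Real.exp (-(ε * ((((r + 1) / 2 : ℕ) : ℝ)) ^ 2)) := by
        apply Real.exp_le_exp.2
        nlinarith
    _ ≤ blockProb 3 (criticalProbI 3) ((r + 1) / 2) := hr
    _ ≤ _ := stub_enclosureOfBlocking r h1

end Summit.CriticalPhenomena.PercolationContinuityZ3.Theorems.SubpolynomialBlocking

end
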